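import Mathlib.Analysis.CStarAlgebra.Unitary.Connected
import Mathlib.Analysis.CStarAlgebra.Matrix
import Mathlib.Analysis.Calculus.MeanValue
import Mathlib.LinearAlgebra.Eigenspace.Minpoly
import Mathlib.LinearAlgebra.UnitaryGroup
import Mathlib.LinearAlgebra.Matrix.Hermitian
import Mathlib.MeasureTheory.Measure.Lebesgue.EqHaar
import Mathlib.MeasureTheory.Measure.Haar.Unique
import Literature.MathematicalPhysics.QuantumLattice.GaugeGroups
import HarnessLib

/-!
# Haar measure of small operator-norm balls in `U(N)`: a lower bound uniform in `N`

For every left-invariant probability measure `μ` on the unitary group `U(N)` (in particular the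
normalised Haar measure `haarProbability (Matrix.unitaryGroup (Fin N) ℂ)` of the tree) and every
`ρ > 0`,

  `μ {V ∈ U(N) : ‖V − 1‖_op ≤ ρ} ≥ (ρ / (2π + ρ))^{N²}`            (`haar_unitaryOpBall_ge`),

i.e. `≥ exp(−N²(log(1/ρ) + log(2π + 1)))` for `ρ ≤ 1`: the small-ball probability decays like
`ρ^{dim U(N)} = ρ^{N²}` with an `N`-UNIFORM constant per dimension. This is the entropy input of the
collapsed-vacuum lower bound `Z_EK ≥ exp(−N²((d/4) log b + C))` for the Eguchi–Kawai partition
function (`EKPartitionLowerBound` in `EguchiKawaiBreakdownProofs.lean`, proved in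
`EguchiKawaiBreakdownLowerBound.lean`), where the exponent `N²` (and not, e.g., the `2N²` of the
ambient real vector space of complex matrices) is essential.

## The argument (no Weyl integration formula)

Mathlib has neither the Weyl integration formula nor the Riemannian volume of `U(N)`, so the bound
is proved by a COVERING argument using only left invariance:

* every unitary matrix is `U = e^{iH}` with `H` self-adjoint and `‖H‖_op ≤ π`: `H = arg(U)` by the
  continuous functional calculus (Mathlib's `Unitary.argSelfAdjoint`; on matrices the spectrum is
  finite, so `arg` is continuous on it and `expUnitary (argSelfAdjoint U) = U` holds with NO
  restriction `‖U − 1‖ < 2`) — `expUnitary_argSelfAdjoint_of_continuousOn`, `exists_uCoords_eq`;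
* `H ↦ e^{iH}` is `1`-Lipschitz in operator norm on self-adjoints of any C⋆-algebra (Duhamel's
  formula `e^{ia} − e^{ib} = ∫₀¹ e^{ita} i(a − b) e^{i(1−t)b} dt` as a mean-value inequality) —
  `norm_expUnitary_sub_expUnitary_le`;
* Hermitian `N × N` matrices are parametrised linearly by `ℝ^{N²}` (`uHerm`, `uCoords`), and the
  pulled-back operator norm `uOpNorm` is a norm there whose balls are bounded open sets; Lebesgue
  volume scaling `vol(c • S) = c^{N²} vol(S)` (`Measure.addHaar_smul_of_nonneg`) gives the PACKING
  bound: a `ρ`-separated subset of `{uOpNorm ≤ R}` has `≤ ((2R + ρ)/ρ)^{N²}` points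
  (`card_le_of_uOpNorm_separated`), hence a maximal one is a `ρ`-NET of that size
  (`exists_uOpNorm_net`);
* the images `e^{i uHerm y}` of a `ρ`-net of `{uOpNorm ≤ π}` are within `ρ` of every unitary, so the
  left translates of the ball cover `U(N)` and `1 = μ(U(N)) ≤ #net · μ(ball)`.

## References

* Folklore (metric entropy of the unitary group; e.g. S. Szarek, *Metric entropy of homogeneous
  spaces*, Banach Center Publ. 43 (1998), for the sharp two-sided version). Everything here is
  proved from Mathlib.
-/

open Complex NormedSpace selfAdjoint Unitary MeasureTheory
open scoped Real Matrix.Norms.L2Operator Pointwise ENNReal NNReal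

noncomputable section

namespace Literature.Barriers.QuantumFields

/-! ### Two lemmas on the exponential map of a C⋆-algebra -/

section General
variable {A : Type*} [CStarAlgebra A]

/-- `e^{i arg u} = u` for a unitary `u` as soon as `arg` is continuous on its spectrum (Mathlib's
`expUnitary_argSelfAdjoint` assumes `‖u − 1‖ < 2`, i.e. `−1 ∉ σ(u)`; for finite spectrum no
assumption is needed). Same proof as Mathlib's. [folklore] -/
lemma expUnitary_argSelfAdjoint_of_continuousOn {u : unitary A}
    (hc : ContinuousOn arg (spectrum ℂ (u : A))) :
    expUnitary (argSelfAdjoint u) = u := by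
  ext
  rw [expUnitary_coe, argSelfAdjoint_coe, ← CFC.exp_eq_normedSpace_exp (𝕜 := ℂ),
    ← cfc_comp_smul .., ← cfc_comp' ..]
  conv_rhs => rw [← cfc_id' ℂ (u : A)]
  refine cfc_congr fun y hy ↦ ?_
  have hy₁ : ‖y‖ = 1 := spectrum.norm_eq_one_of_unitary u.2 hy
  have : I * y.arg = log y :=
    Complex.ext (by simp [log_re, spectrum.norm_eq_one_of_unitary u.2 hy]) (by simp [log_im])
  simpa [← exp_eq_exp_ℂ, this] using exp_log (by aesop)

/-- `e^{t·(ix)}` is unitary for self-adjoint `x` and real `t`. [folklore] -/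
lemma exp_real_smul_I_smul_mem_unitary (x : selfAdjoint A) (t : ℝ) :
    exp (t • (I • (x : A))) ∈ unitary A := by
  have : t • (I • (x : A)) = I • ((t • x : selfAdjoint A) : A) := by
    rw [selfAdjoint.val_smul, smul_comm]
  rw [this]
  exact (expUnitary (t • x)).2

/-- **The exponential map `x ↦ e^{ix}` is `1`-Lipschitz from the self-adjoints to the unitaries
of a C⋆-algebra (operator norm on both sides).** Duhamel: with `F(t) = e^{ita} e^{i(1−t)b}` one
has `F' = e^{ita} i(a − b) e^{i(1−t)b}`, `‖F'‖ ≤ ‖a − b‖` (unitaries have norm `1`), and the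
mean-value inequality on `[0, 1]` gives `‖e^{ia} − e^{ib}‖ = ‖F 1 − F 0‖ ≤ ‖a − b‖`. [folklore] -/
lemma norm_expUnitary_sub_expUnitary_le (x y : selfAdjoint A) :
    ‖((expUnitary x : A) - (expUnitary y : A))‖ ≤ ‖((x : A) - (y : A))‖ := by
  nontriviality A
  set a : A := I • (x : A) with ha
  set b : A := I • (y : A) with hb
  set F : ℝ → A := fun t => exp (t • a) * exp ((1 - t) • b) with hF
  have hF1 : F 1 = expUnitary x := by simp [hF, ha]
  have hF0 : F 0 = expUnitary y := by simp [hF, hb]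
  have hderiv : ∀ t : ℝ, HasDerivAt F
      ((exp (t • a) * a) * exp ((1 - t) • b) +
        exp (t • a) * ((-1 : ℝ) • (exp ((1 - t) • b) * b))) t := by
    intro t
    have h1 : HasDerivAt (fun u : ℝ => exp (u • a)) (exp (t • a) * a) t :=
      hasDerivAt_exp_smul_const a t
    have h2 : HasDerivAt (fun u : ℝ => exp ((1 - u) • b))
        ((-1 : ℝ) • (exp ((1 - t) • b) * b)) t := by
      have hg : HasDerivAt (fun s : ℝ => exp (s • b)) (exp ((1 - t) • b) * b) (1 - t) :=
        hasDerivAt_exp_smul_const b (1 - t)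
      have hh : HasDerivAt (fun u : ℝ => 1 - u) (-1 : ℝ) t := by
        simpa using (hasDerivAt_id t).const_sub (1 : ℝ)
      exact hg.scomp t hh
    exact h1.mul h2
  have hbound : ∀ t ∈ Set.Ico (0 : ℝ) 1,
      ‖(exp (t • a) * a) * exp ((1 - t) • b) +
          exp (t • a) * ((-1 : ℝ) • (exp ((1 - t) • b) * b))‖ ≤ ‖((x : A) - (y : A))‖ := by
    intro t _
    have hcomm : exp ((1 - t) • b) * b = b * exp ((1 - t) • b) :=
      (((Commute.refl b).smul_left (1 - t)).exp_left).eq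
    have hrw : (exp (t • a) * a) * exp ((1 - t) • b) +
          exp (t • a) * ((-1 : ℝ) • (exp ((1 - t) • b) * b))
        = exp (t • a) * (a - b) * exp ((1 - t) • b) := by
      rw [hcomm, neg_one_smul]
      noncomm_ring
    rw [hrw]
    have hP : ‖exp (t • a)‖ = 1 :=
      CStarRing.norm_of_mem_unitary (exp_real_smul_I_smul_mem_unitary x t)
    have hE : ‖exp ((1 - t) • b)‖ = 1 :=
      CStarRing.norm_of_mem_unitary (exp_real_smul_I_smul_mem_unitary y (1 - t))
    have hab : ‖a - b‖ = ‖((x : A) - (y : A))‖ := by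
      rw [ha, hb, ← smul_sub, norm_smul, Complex.norm_I, one_mul]
    calc ‖exp (t • a) * (a - b) * exp ((1 - t) • b)‖
        ≤ ‖exp (t • a)‖ * ‖a - b‖ * ‖exp ((1 - t) • b)‖ := norm_mul₃_le
      _ = ‖((x : A) - (y : A))‖ := by rw [hP, hE, hab, one_mul, mul_one]
  have := norm_image_sub_le_of_norm_deriv_le_segment_01'
    (fun t _ => (hderiv t).hasDerivWithinAt) hbound
  rwa [hF1, hF0] at this

end General

/-! ### Hermitian matrices in real coordinates -/

section Mat
variable {N : ℕ}

/-- Real coordinates for Hermitian `N × N` matrices: the matrix `uHerm x` has entries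
`x(i,i)` on the diagonal, `x(i,j) + i·x(j,i)` above it (`i < j`) and the conjugates below.
[folklore] -/
def uHerm (x : Fin N × Fin N → ℝ) : Matrix (Fin N) (Fin N) ℂ := Matrix.of fun i j =>
  if i = j then ((x (i, i) : ℝ) : ℂ)
  else if i < j then (x (i, j) : ℂ) + (x (j, i) : ℂ) * I
  else (x (j, i) : ℂ) - (x (i, j) : ℂ) * I

/-- Diagonal entries of `uHerm x`. [folklore] -/
theorem uHerm_apply_self (x : Fin N × Fin N → ℝ) (i : Fin N) : uHerm x i i = x (i, i) := by
  simp [uHerm, Matrix.of_apply]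

/-- Upper entries of `uHerm x`. [folklore] -/
theorem uHerm_apply_lt (x : Fin N × Fin N → ℝ) {i j : Fin N} (h : i < j) :
    uHerm x i j = (x (i, j) : ℂ) + (x (j, i) : ℂ) * I := by
  simp [uHerm, Matrix.of_apply, h, h.ne]

/-- Lower entries of `uHerm x`. [folklore] -/
theorem uHerm_apply_gt (x : Fin N × Fin N → ℝ) {i j : Fin N} (h : j < i) :
    uHerm x i j = (x (j, i) : ℂ) - (x (i, j) : ℂ) * I := by
  simp [uHerm, Matrix.of_apply, h.ne', not_lt.2 h.le]

/-- `uHerm x` is Hermitian. [folklore] -/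
theorem uHerm_isHermitian (x : Fin N × Fin N → ℝ) : Matrix.IsHermitian (uHerm x) := by
  apply Matrix.IsHermitian.ext
  intro i j
  rcases lt_trichotomy i j with h | h | h
  · rw [uHerm_apply_lt x h, uHerm_apply_gt x h]
    simp
  · subst h; rw [uHerm_apply_self]; simp
  · rw [uHerm_apply_gt x h, uHerm_apply_lt x h]
    simp [Complex.ext_iff]

/-- `uHerm x` is self-adjoint. [folklore] -/
theorem uHerm_isSelfAdjoint (x : Fin N × Fin N → ℝ) : IsSelfAdjoint (uHerm x) :=
  (uHerm_isHermitian x).isSelfAdjoint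

/-- `uHerm` is additive. [folklore] -/
theorem uHerm_add (x y : Fin N × Fin N → ℝ) : uHerm (x + y) = uHerm x + uHerm y := by
  ext i j
  rcases lt_trichotomy i j with h | h | h
  · simp only [Matrix.add_apply, uHerm_apply_lt _ h, Pi.add_apply]; push_cast; ring
  · subst h; simp only [Matrix.add_apply, uHerm_apply_self, Pi.add_apply]; push_cast; ring
  · simp only [Matrix.add_apply, uHerm_apply_gt _ h, Pi.add_apply]; push_cast; ring

/-- `uHerm` is `ℝ`-homogeneous. [folklore] -/
theorem uHerm_smul (c : ℝ) (x : Fin N × Fin N → ℝ) : uHerm (c • x) = c • uHerm x := by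
  ext i j
  rcases lt_trichotomy i j with h | h | h
  · simp only [Matrix.smul_apply, uHerm_apply_lt _ h, Pi.smul_apply, smul_eq_mul,
      Complex.real_smul]
    push_cast; ring
  · subst h
    simp only [Matrix.smul_apply, uHerm_apply_self, Pi.smul_apply, smul_eq_mul, Complex.real_smul]
    push_cast; ring
  · simp only [Matrix.smul_apply, uHerm_apply_gt _ h, Pi.smul_apply, smul_eq_mul,
      Complex.real_smul]
    push_cast; ring

/-- `uHerm` respects subtraction. [folklore] -/
theorem uHerm_sub (x y : Fin N × Fin N → ℝ) : uHerm (x - y) = uHerm x - uHerm y := by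
  rw [sub_eq_add_neg, uHerm_add, ← neg_one_smul ℝ y, uHerm_smul, neg_one_smul, sub_eq_add_neg]

/-- `uHerm 0 = 0`. [folklore] -/
theorem uHerm_zero : uHerm (0 : Fin N × Fin N → ℝ) = 0 := by
  have := uHerm_smul (0 : ℝ) (0 : Fin N × Fin N → ℝ)
  rwa [zero_smul, zero_smul] at this

/-- The inverse coordinates of a matrix: real parts on and above the diagonal, imaginary parts
(of the transposed entry) below. [folklore] -/
def uCoords (H : Matrix (Fin N) (Fin N) ℂ) : Fin N × Fin N → ℝ := fun p =>
  if p.1 ≤ p.2 then (H p.1 p.2).re else (H p.2 p.1).im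

/-- Every Hermitian matrix is `uHerm` of its coordinates. [folklore] -/
theorem uHerm_uCoords {H : Matrix (Fin N) (Fin N) ℂ} (hH : Matrix.IsHermitian H) :
    uHerm (uCoords H) = H := by
  ext i j
  have hji : H j i = star (H i j) := by
    conv_lhs => rw [← hH]
    rfl
  rcases lt_trichotomy i j with h | h | h
  · rw [uHerm_apply_lt _ h]
    simp only [uCoords, h.le, if_true, not_le.2 h, if_false]
    apply Complex.ext <;> simp
  · subst h
    rw [uHerm_apply_self]
    simp only [uCoords, le_refl, if_true]
    have hreal : (H i i).im = 0 := by
      have := congrArg Complex.im hji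
      simp only [Complex.star_def, Complex.conj_im] at this
      linarith
    apply Complex.ext <;> simp [hreal]
  · rw [uHerm_apply_gt _ h]
    simp only [uCoords, h.le, if_true, not_le.2 h, if_false]
    rw [hji]
    apply Complex.ext <;> simp

/-- Each coordinate is dominated by the modulus of some entry of `uHerm x`. [folklore] -/
theorem abs_uCoord_le_norm_entry (x : Fin N × Fin N → ℝ) (p : Fin N × Fin N) :
    ∃ q : Fin N × Fin N, |x p| ≤ ‖uHerm x q.1 q.2‖ := by
  obtain ⟨i, j⟩ := p
  rcases lt_trichotomy i j with h | h | h
  · refine ⟨(i, j), ?_⟩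
    rw [uHerm_apply_lt _ h]
    calc |x (i, j)| = |((x (i, j) : ℂ) + (x (j, i) : ℂ) * I).re| := by simp
      _ ≤ _ := Complex.abs_re_le_norm _
  · subst h
    refine ⟨(i, i), ?_⟩
    rw [uHerm_apply_self]; simp
  · refine ⟨(j, i), ?_⟩
    rw [uHerm_apply_lt _ h]
    calc |x (i, j)| = |((x (j, i) : ℂ) + (x (i, j) : ℂ) * I).im| := by simp
      _ ≤ _ := Complex.abs_im_le_norm _

/-! ### The pulled-back operator norm on `ℝ^{N²}` -/

/-- Entries are bounded by the L²-operator norm: `|A i j| ≤ ‖A‖_op` (test against the basis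
vector `e_j`). [folklore] -/
theorem norm_entry_le_l2_opNorm (A : Matrix (Fin N) (Fin N) ℂ) (i j : Fin N) : ‖A i j‖ ≤ ‖A‖ := by
  set v : EuclideanSpace ℂ (Fin N) := PiLp.single 2 j (1 : ℂ) with hv
  have hv1 : ‖v‖ = 1 := by rw [hv, PiLp.norm_single, norm_one]
  have h1 := Matrix.l2_opNorm_mulVec A v
  rw [hv1, mul_one] at h1
  have h2 : ‖((EuclideanSpace.equiv (Fin N) ℂ).symm (Matrix.mulVec A v.ofLp)) i‖ ≤
      ‖(EuclideanSpace.equiv (Fin N) ℂ).symm (Matrix.mulVec A v.ofLp)‖ := PiLp.norm_apply_le _ i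
  have h3 : ((EuclideanSpace.equiv (Fin N) ℂ).symm (Matrix.mulVec A v.ofLp)) i = A i j := by
    have : v.ofLp = Pi.single j 1 := by
      rw [hv]; rfl
    simp [this]
  rw [h3] at h2
  exact h2.trans h1

/-- The operator norm in coordinates, `uOpNorm x = ‖uHerm x‖_op`. [folklore] -/
def uOpNorm (x : Fin N × Fin N → ℝ) : ℝ := ‖uHerm x‖

/-- `uOpNorm ≥ 0`. [folklore] -/
theorem uOpNorm_nonneg (x : Fin N × Fin N → ℝ) : 0 ≤ uOpNorm x := norm_nonneg _

/-- `uOpNorm (x − y) = uOpNorm (y − x)`. [folklore] -/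
theorem uOpNorm_sub_comm (x y : Fin N × Fin N → ℝ) : uOpNorm (x - y) = uOpNorm (y - x) := by
  rw [uOpNorm, uOpNorm, uHerm_sub, uHerm_sub, norm_sub_rev]

/-- Triangle inequality for `uOpNorm`. [folklore] -/
theorem uOpNorm_add_le (x y : Fin N × Fin N → ℝ) : uOpNorm (x + y) ≤ uOpNorm x + uOpNorm y := by
  rw [uOpNorm, uOpNorm, uOpNorm, uHerm_add]; exact norm_add_le _ _

/-- Absolute homogeneity of `uOpNorm`. [folklore] -/
theorem uOpNorm_smul (c : ℝ) (x : Fin N × Fin N → ℝ) : uOpNorm (c • x) = |c| * uOpNorm x := by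
  rw [uOpNorm, uOpNorm, uHerm_smul, norm_smul, Real.norm_eq_abs]

/-- `uOpNorm 0 = 0`. [folklore] -/
theorem uOpNorm_zero : uOpNorm (0 : Fin N × Fin N → ℝ) = 0 := by
  rw [uOpNorm, uHerm_zero, norm_zero]

/-- Coordinates are bounded by `uOpNorm` (so its balls are bounded sets). [folklore] -/
theorem abs_uCoord_le_uOpNorm (x : Fin N × Fin N → ℝ) (p : Fin N × Fin N) : |x p| ≤ uOpNorm x := by
  obtain ⟨q, hq⟩ := abs_uCoord_le_norm_entry x p
  exact hq.trans (norm_entry_le_l2_opNorm _ _ _)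

/-- `uHerm` is continuous. [folklore] -/
theorem continuous_uHerm : Continuous (uHerm (N := N)) := by
  refine continuous_pi fun i => continuous_pi fun j => ?_
  rcases lt_trichotomy i j with h | h | h
  · simp_rw [uHerm_apply_lt _ h]; fun_prop
  · subst h; simp_rw [uHerm_apply_self]; fun_prop
  · simp_rw [uHerm_apply_gt _ h]; fun_prop

/-- `uOpNorm` is continuous. [folklore] -/
theorem continuous_uOpNorm : Continuous (uOpNorm (N := N)) :=
  continuous_norm.comp continuous_uHerm

/-- The open `uOpNorm`-ball `{x : uOpNorm x < R}` of `ℝ^{N²}`. [folklore] -/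
def uOpBall (N : ℕ) (R : ℝ) : Set (Fin N × Fin N → ℝ) := {x | uOpNorm x < R}

/-- The ball is open. [folklore] -/
theorem isOpen_uOpBall (R : ℝ) : IsOpen (uOpBall N R) :=
  isOpen_lt continuous_uOpNorm continuous_const

/-- Scaling of balls: `c • {uOpNorm < R} = {uOpNorm < cR}` for `c > 0`. [folklore] -/
theorem smul_uOpBall {c R : ℝ} (hc : 0 < c) : c • uOpBall N R = uOpBall N (c * R) := by
  ext z
  rw [Set.mem_smul_set_iff_inv_smul_mem₀ hc.ne', uOpBall, uOpBall, Set.mem_setOf_eq,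
    Set.mem_setOf_eq, uOpNorm_smul, abs_inv, abs_of_pos hc, inv_mul_lt_iff₀ hc]

/-- The ball is bounded (in the sup norm of `ℝ^{N²}`). [folklore] -/
theorem isBounded_uOpBall (R : ℝ) : Bornology.IsBounded (uOpBall N R) := by
  rw [isBounded_iff_forall_norm_le]
  refine ⟨R, fun x hx => ?_⟩
  have hx' : uOpNorm x < R := hx
  have hR : 0 ≤ R := (uOpNorm_nonneg x).trans hx'.le
  refine (pi_norm_le_iff_of_nonneg hR).2 fun p => ?_
  rw [Real.norm_eq_abs]
  exact (abs_uCoord_le_uOpNorm x p).trans hx'.le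

/-! ### Volumetric packing and nets in `ℝ^{N²}` -/

/-- `dim_ℝ ℝ^{N×N} = N²`. [folklore] -/
theorem finrank_uCoordSpace : Module.finrank ℝ (Fin N × Fin N → ℝ) = N * N := by
  rw [Module.finrank_fintype_fun_eq_card, Fintype.card_prod, Fintype.card_fin]

/-- `0` lies in every ball of positive radius. [folklore] -/
theorem zero_mem_uOpBall {R : ℝ} (hR : 0 < R) : (0 : Fin N × Fin N → ℝ) ∈ uOpBall N R := by
  simp only [uOpBall, Set.mem_setOf_eq, uOpNorm_zero]; exact hR

/-- Balls of positive radius have positive Lebesgue measure. [folklore] -/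
theorem volume_uOpBall_pos {R : ℝ} (hR : 0 < R) : 0 < volume (uOpBall N R) :=
  (isOpen_uOpBall R).measure_pos volume ⟨0, zero_mem_uOpBall hR⟩

/-- Balls have finite Lebesgue measure. [folklore] -/
theorem volume_uOpBall_lt_top (R : ℝ) : volume (uOpBall N R) < ⊤ :=
  (isBounded_uOpBall R).measure_lt_top

/-- **Packing bound.** A `ρ`-separated (for `uOpNorm`) finite subset of `{uOpNorm ≤ R}` has at
most `((2R + ρ)/ρ)^{N²}` elements: the `ρ/2`-balls around its points are disjoint, contained in the
`(R + ρ/2)`-ball, and Lebesgue measure scales with the power `N² = dim`. [folklore] -/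
theorem card_le_of_uOpNorm_separated {R ρ : ℝ} (hR : 0 ≤ R) (hρ : 0 < ρ)
    (F : Finset (Fin N × Fin N → ℝ)) (hF : ∀ x ∈ F, uOpNorm x ≤ R)
    (hsep : ∀ x ∈ F, ∀ y ∈ F, x ≠ y → ρ ≤ uOpNorm (x - y)) :
    (F.card : ℝ) ≤ ((2 * R + ρ) / ρ) ^ (N * N) := by
  set R' : ℝ := R + ρ / 2 with hR'def
  have hR' : 0 < R' := by rw [hR'def]; linarith
  set c : ℝ := (ρ / 2) / R' with hcdef
  have hc : 0 < c := div_pos (by linarith) hR'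
  set B : (Fin N × Fin N → ℝ) → Set (Fin N × Fin N → ℝ) :=
    fun x => (fun z => z + (-x)) ⁻¹' uOpBall N (ρ / 2) with hBdef
  have hBmem : ∀ x z, z ∈ B x ↔ uOpNorm (z - x) < ρ / 2 := by
    intro x z; simp [hBdef, uOpBall, sub_eq_add_neg]
  have hBmeas : ∀ x, MeasurableSet (B x) := fun x =>
    (isOpen_uOpBall _).measurableSet.preimage (measurable_add_const (-x))
  have hBvol : ∀ x, volume (B x) = volume (uOpBall N (ρ / 2)) := fun x =>
    measure_preimage_add_right volume (-x) (uOpBall N (ρ / 2))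
  have hBsub : ∀ x ∈ F, B x ⊆ uOpBall N R' := by
    intro x hx z hz
    rw [hBmem] at hz
    show uOpNorm z < R'
    have : uOpNorm z ≤ uOpNorm (z - x) + uOpNorm x := by
      have h := uOpNorm_add_le (z - x) x
      rwa [sub_add_cancel] at h
    have hxR := hF x hx
    rw [hR'def]; linarith
  have hdisj : (F : Set (Fin N × Fin N → ℝ)).PairwiseDisjoint B := by
    intro x hx y hy hxy
    rw [Function.onFun, Set.disjoint_left]
    intro z hzx hzy
    rw [hBmem] at hzx hzy
    have h1 : uOpNorm (x - y) ≤ uOpNorm (x - z) + uOpNorm (z - y) := by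
      have h := uOpNorm_add_le (x - z) (z - y)
      rwa [sub_add_sub_cancel] at h
    rw [uOpNorm_sub_comm x z] at h1
    have h2 := hsep x hx y hy hxy
    linarith
  have hscale : uOpBall N (ρ / 2) = c • uOpBall N R' := by
    rw [smul_uOpBall hc, hcdef, div_mul_cancel₀ _ hR'.ne']
  have hvolB : volume (uOpBall N (ρ / 2)) =
      ENNReal.ofReal (c ^ (N * N)) * volume (uOpBall N R') := by
    rw [hscale, Measure.addHaar_smul_of_nonneg volume hc.le, finrank_uCoordSpace]
  have hsum : ∑ x ∈ F, volume (B x) = volume (⋃ x ∈ F, B x) :=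
    (measure_biUnion_finset hdisj (fun x _ => hBmeas x)).symm
  have hle : volume (⋃ x ∈ F, B x) ≤ volume (uOpBall N R') :=
    measure_mono (Set.iUnion₂_subset hBsub)
  have key : ((F.card : ℝ≥0∞) * ENNReal.ofReal (c ^ (N * N))) * volume (uOpBall N R') ≤
      1 * volume (uOpBall N R') := by
    rw [one_mul, mul_assoc, ← hvolB]
    calc (F.card : ℝ≥0∞) * volume (uOpBall N (ρ / 2)) = ∑ x ∈ F, volume (B x) := by
          rw [Finset.sum_congr rfl (fun x _ => hBvol x), Finset.sum_const, nsmul_eq_mul]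
      _ ≤ volume (uOpBall N R') := hsum ▸ hle
  have hV0 : volume (uOpBall N R') ≠ 0 := (volume_uOpBall_pos hR').ne'
  have hVt : volume (uOpBall N R') ≠ ⊤ := (volume_uOpBall_lt_top R').ne
  have key2 : (F.card : ℝ≥0∞) * ENNReal.ofReal (c ^ (N * N)) ≤ 1 :=
    (ENNReal.mul_le_mul_iff_left hV0 hVt).1 key
  have key3 : (F.card : ℝ) * c ^ (N * N) ≤ 1 := by
    have h : ENNReal.ofReal ((F.card : ℝ) * c ^ (N * N)) ≤ ENNReal.ofReal 1 := by
      rw [ENNReal.ofReal_mul (Nat.cast_nonneg _), ENNReal.ofReal_natCast, ENNReal.ofReal_one]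
      exact key2
    exact (ENNReal.ofReal_le_ofReal_iff zero_le_one).1 h
  have hcn : 0 < c ^ (N * N) := pow_pos hc _
  have hinv : ((2 * R + ρ) / ρ) ^ (N * N) = 1 / c ^ (N * N) := by
    rw [hcdef, hR'def, one_div, ← inv_pow]
    congr 1
    field_simp
  rw [hinv, le_div_iff₀ hcn, one_mul] at *
  linarith

/-- **Nets.** `{uOpNorm ≤ R}` has a finite `ρ`-net (for `uOpNorm`) with at most `((2R + ρ)/ρ)^{N²}`
points — a maximal `ρ`-separated subset, which exists by the packing bound. [folklore] -/
theorem exists_uOpNorm_net {R ρ : ℝ} (hR : 0 ≤ R) (hρ : 0 < ρ) :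
    ∃ F : Finset (Fin N × Fin N → ℝ), (∀ y ∈ F, uOpNorm y ≤ R) ∧
      (F.card : ℝ) ≤ ((2 * R + ρ) / ρ) ^ (N * N) ∧
      ∀ x, uOpNorm x ≤ R → ∃ y ∈ F, uOpNorm (x - y) < ρ := by
  classical
  let good : Finset (Fin N × Fin N → ℝ) → Prop := fun F =>
    (∀ y ∈ F, uOpNorm y ≤ R) ∧ (∀ x ∈ F, ∀ y ∈ F, x ≠ y → ρ ≤ uOpNorm (x - y))
  let P : ℕ → Prop := fun k => ∃ F, good F ∧ F.card = k
  set Bd : ℕ := ⌊((2 * R + ρ) / ρ) ^ (N * N)⌋₊ with hBd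
  have hcard : ∀ F, good F → F.card ≤ Bd := by
    intro F hF
    exact Nat.le_floor (card_le_of_uOpNorm_separated hR hρ F hF.1 hF.2)
  have hP0 : P 0 := ⟨∅, ⟨by simp, by simp⟩, rfl⟩
  set k₀ := Nat.findGreatest P Bd with hk₀
  have hPk₀ : P k₀ := Nat.findGreatest_spec (Nat.zero_le Bd) hP0
  obtain ⟨F₀, hgood, hcardF₀⟩ := hPk₀
  refine ⟨F₀, hgood.1, card_le_of_uOpNorm_separated hR hρ F₀ hgood.1 hgood.2, ?_⟩
  intro x hx
  by_contra hcon
  push Not at hcon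
  have hxF : x ∉ F₀ := by
    intro hxF
    have := hcon x hxF
    rw [sub_self, uOpNorm_zero] at this
    linarith
  have hgood' : good (insert x F₀) := by
    refine ⟨?_, ?_⟩
    · intro y hy
      rcases Finset.mem_insert.1 hy with rfl | hy
      · exact hx
      · exact hgood.1 y hy
    · intro a ha b hb hab
      rw [Finset.mem_insert] at ha hb
      rcases ha with ha | ha
      · rcases hb with hb | hb
        · exact absurd (ha.trans hb.symm) hab
        · rw [ha]; exact hcon b hb
      · rcases hb with hb | hb
        · rw [hb, uOpNorm_sub_comm]; exact hcon a ha
        · exact hgood.2 a ha b hb hab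
  have hP1 : P (k₀ + 1) :=
    ⟨insert x F₀, hgood', by rw [Finset.card_insert_of_notMem hxF, hcardF₀]⟩
  have hle : k₀ + 1 ≤ Bd := by
    have := hcard _ hgood'
    rwa [Finset.card_insert_of_notMem hxF, hcardF₀] at this
  exact Nat.findGreatest_is_greatest (Nat.lt_succ_self k₀) hle hP1

/-! ### The Haar measure of operator-norm balls in `U(N)` -/

/-- The closed operator-norm ball `{V ∈ U(N) : ‖V − 1‖_op ≤ ρ}` around the identity (L²-operator
norm, Mathlib's scoped `Matrix.Norms.L2Operator`). [folklore] -/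
def unitaryOpBall (N : ℕ) (ρ : ℝ) : Set (Matrix.unitaryGroup (Fin N) ℂ) :=
  {V | ‖(V : Matrix (Fin N) (Fin N) ℂ) - 1‖ ≤ ρ}

/-- Membership in the ball. [folklore] -/
theorem mem_unitaryOpBall {ρ : ℝ} {V : Matrix.unitaryGroup (Fin N) ℂ} :
    V ∈ unitaryOpBall N ρ ↔ ‖(V : Matrix (Fin N) (Fin N) ℂ) - 1‖ ≤ ρ := Iff.rfl

/-- The ball is closed. [folklore] -/
theorem isClosed_unitaryOpBall (ρ : ℝ) : IsClosed (unitaryOpBall N ρ) :=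
  isClosed_le ((continuous_subtype_val.sub continuous_const).norm) continuous_const

/-- The ball is (Borel) measurable. [folklore] -/
theorem measurableSet_unitaryOpBall (ρ : ℝ) : MeasurableSet (unitaryOpBall N ρ) :=
  (isClosed_unitaryOpBall ρ).measurableSet

/-- The unitary matrix `e^{i uHerm y}`. [folklore] -/
def expHermUnitary (y : Fin N × Fin N → ℝ) : Matrix.unitaryGroup (Fin N) ℂ :=
  expUnitary ⟨uHerm y, uHerm_isSelfAdjoint y⟩

/-- **Surjectivity of `exp` with norm control**: every unitary matrix is `e^{iH}` with
`H = uHerm x` Hermitian and `‖H‖_op ≤ π` (namely `H = arg U` by the continuous functional calculus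
in the C⋆-algebra `M_N(ℂ)`; the spectrum is finite, so `arg` is continuous on it). [folklore] -/
theorem exists_uCoords_eq (U : Matrix.unitaryGroup (Fin N) ℂ) :
    ∃ x : Fin N × Fin N → ℝ, uOpNorm x ≤ π ∧ expHermUnitary x = U := by
  letI : CStarAlgebra (Matrix (Fin N) (Fin N) ℂ) := {}
  set H : selfAdjoint (Matrix (Fin N) (Fin N) ℂ) := argSelfAdjoint U with hH
  have hHerm : Matrix.IsHermitian (H : Matrix (Fin N) (Fin N) ℂ) :=
    Matrix.isHermitian_iff_isSelfAdjoint.2 H.2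
  refine ⟨uCoords (H : Matrix (Fin N) (Fin N) ℂ), ?_, ?_⟩
  · rw [uOpNorm, uHerm_uCoords hHerm]
    exact norm_argSelfAdjoint_le_pi U
  · have h1 : expHermUnitary (uCoords (H : Matrix (Fin N) (Fin N) ℂ)) = expUnitary H := by
      unfold expHermUnitary
      congr 1
      exact Subtype.ext (uHerm_uCoords hHerm)
    rw [h1, hH]
    exact expUnitary_argSelfAdjoint_of_continuousOn
      ((Matrix.finite_spectrum (U : Matrix (Fin N) (Fin N) ℂ)).continuousOn _)

/-- `‖e^{i uHerm x} − e^{i uHerm y}‖_op ≤ uOpNorm (x − y)` (the `1`-Lipschitz bound). [folklore] -/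
theorem norm_expHermUnitary_sub_le (x y : Fin N × Fin N → ℝ) :
    ‖(expHermUnitary x : Matrix (Fin N) (Fin N) ℂ) - (expHermUnitary y : Matrix (Fin N) (Fin N) ℂ)‖
      ≤ uOpNorm (x - y) := by
  letI : CStarAlgebra (Matrix (Fin N) (Fin N) ℂ) := {}
  rw [uOpNorm, uHerm_sub]
  exact norm_expUnitary_sub_expUnitary_le _ _

/-- Left translation: `‖U − W‖_op ≤ ρ` for unitaries puts `W⁻¹U` in the `ρ`-ball around `1`
(`W⁻¹U − 1 = W⋆(U − W)` and `‖W⋆‖ = 1`). [folklore] -/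
theorem inv_mul_mem_unitaryOpBall {U W : Matrix.unitaryGroup (Fin N) ℂ} {ρ : ℝ}
    (h : ‖(U : Matrix (Fin N) (Fin N) ℂ) - (W : Matrix (Fin N) (Fin N) ℂ)‖ ≤ ρ) :
    W⁻¹ * U ∈ unitaryOpBall N ρ := by
  rw [mem_unitaryOpBall]
  have hW : (star (W : Matrix (Fin N) (Fin N) ℂ)) * (W : Matrix (Fin N) (Fin N) ℂ) = 1 :=
    Unitary.coe_star_mul_self W
  have : ((W⁻¹ * U : Matrix.unitaryGroup (Fin N) ℂ) : Matrix (Fin N) (Fin N) ℂ) - 1 =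
      star (W : Matrix (Fin N) (Fin N) ℂ) *
        ((U : Matrix (Fin N) (Fin N) ℂ) - (W : Matrix (Fin N) (Fin N) ℂ)) := by
    rw [mul_sub, hW]
    rfl
  rw [this]
  calc ‖star (W : Matrix (Fin N) (Fin N) ℂ) *
        ((U : Matrix (Fin N) (Fin N) ℂ) - (W : Matrix (Fin N) (Fin N) ℂ))‖
      ≤ ‖star (W : Matrix (Fin N) (Fin N) ℂ)‖ *
          ‖(U : Matrix (Fin N) (Fin N) ℂ) - (W : Matrix (Fin N) (Fin N) ℂ)‖ := norm_mul_le _ _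
    _ ≤ 1 * ρ := by
        refine mul_le_mul ?_ h (norm_nonneg _) zero_le_one
        obtain h0 | h0 := subsingleton_or_nontrivial (Matrix (Fin N) (Fin N) ℂ)
        · simp [Subsingleton.elim (star (W : Matrix (Fin N) (Fin N) ℂ)) 0]
        · exact (CStarRing.norm_of_mem_unitary (Unitary.star_mem W.2)).le
    _ = ρ := one_mul ρ

/-- **Haar measure of small balls in `U(N)`, uniformly in `N`.** For every left-invariant
probability measure `μ` on `U(N)` and every `ρ > 0`,
`μ {V : ‖V − 1‖_op ≤ ρ} ≥ (ρ / (2π + ρ))^{N²}`: the left translates of the ball by the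
`≤ ((2π + ρ)/ρ)^{N²}` unitaries `e^{i uHerm y}`, `y` in a `ρ`-net of `{uOpNorm ≤ π}`, cover `U(N)`.
[folklore] -/
theorem haar_unitaryOpBall_ge (μ : Measure (Matrix.unitaryGroup (Fin N) ℂ)) [IsProbabilityMeasure μ]
    [μ.IsMulLeftInvariant] {ρ : ℝ} (hρ : 0 < ρ) :
    ENNReal.ofReal ((ρ / (2 * π + ρ)) ^ (N * N)) ≤ μ (unitaryOpBall N ρ) := by
  obtain ⟨F, -, hcard, hcov⟩ := exists_uOpNorm_net (N := N) Real.pi_pos.le hρ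
  have hcover : (Set.univ : Set (Matrix.unitaryGroup (Fin N) ℂ)) ⊆
      ⋃ y ∈ F, (fun U => (expHermUnitary y)⁻¹ * U) ⁻¹' unitaryOpBall N ρ := by
    intro U _
    obtain ⟨x, hxπ, hxU⟩ := exists_uCoords_eq U
    obtain ⟨y, hy, hxy⟩ := hcov x hxπ
    refine Set.mem_iUnion₂.2 ⟨y, hy, ?_⟩
    show (expHermUnitary y)⁻¹ * U ∈ unitaryOpBall N ρ
    apply inv_mul_mem_unitaryOpBall
    rw [← hxU]
    exact (norm_expHermUnitary_sub_le x y).trans hxy.le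
  have h1 : μ Set.univ ≤ ∑ y ∈ F, μ ((fun U => (expHermUnitary y)⁻¹ * U) ⁻¹' unitaryOpBall N ρ) :=
    (measure_mono hcover).trans (measure_biUnion_finset_le F _)
  simp only [measure_preimage_mul, measure_univ, Finset.sum_const, nsmul_eq_mul] at h1
  set q : ℝ := (ρ / (2 * π + ρ)) ^ (N * N) with hq
  have hq_le : q * F.card ≤ 1 := by
    have hqinv : q = 1 / ((2 * π + ρ) / ρ) ^ (N * N) := by
      rw [hq, one_div, ← inv_pow, inv_div]
    rw [hqinv]
    have hpos : 0 < ((2 * π + ρ) / ρ) ^ (N * N) := by positivity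
    rw [one_div, inv_mul_le_iff₀ hpos, mul_one]
    exact hcard
  calc ENNReal.ofReal q = ENNReal.ofReal q * 1 := (mul_one _).symm
    _ ≤ ENNReal.ofReal q * ((F.card : ℝ≥0∞) * μ (unitaryOpBall N ρ)) := by gcongr
    _ = ENNReal.ofReal (q * F.card) * μ (unitaryOpBall N ρ) := by
        rw [← mul_assoc, ENNReal.ofReal_mul (by positivity), ENNReal.ofReal_natCast]
    _ ≤ 1 * μ (unitaryOpBall N ρ) := by
        gcongr
        rw [← ENNReal.ofReal_one]
        exact ENNReal.ofReal_le_ofReal hq_le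
    _ = μ (unitaryOpBall N ρ) := one_mul _

/-- The bound in exponential form: for `0 < ρ ≤ 1`,
`μ {V : ‖V − 1‖_op ≤ ρ} ≥ exp(−N²·(log(1/ρ) + log(2π + 1)))`. [folklore] -/
theorem haar_unitaryOpBall_ge_exp (μ : Measure (Matrix.unitaryGroup (Fin N) ℂ))
    [IsProbabilityMeasure μ] [μ.IsMulLeftInvariant] {ρ : ℝ} (hρ : 0 < ρ) (hρ1 : ρ ≤ 1) :
    ENNReal.ofReal (Real.exp (-((N : ℝ) ^ 2 * (Real.log (1 / ρ) + Real.log (2 * π + 1))))) ≤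
      μ (unitaryOpBall N ρ) := by
  refine le_trans (ENNReal.ofReal_le_ofReal ?_) (haar_unitaryOpBall_ge μ hρ)
  have hπ : 0 < 2 * π + 1 := by positivity
  have hX : 0 < ρ⁻¹ * (2 * π + 1) := by positivity
  have h1 : Real.exp (-((N : ℝ) ^ 2 * (Real.log (1 / ρ) + Real.log (2 * π + 1)))) =
      (ρ / (2 * π + 1)) ^ (N * N) := by
    rw [one_div, ← Real.log_mul (inv_pos.2 hρ).ne' hπ.ne']
    rw [show -((N : ℝ) ^ 2 * Real.log (ρ⁻¹ * (2 * π + 1))) =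
        ((N * N : ℕ) : ℝ) * Real.log ((ρ⁻¹ * (2 * π + 1))⁻¹) by
      rw [Real.log_inv]; push_cast; ring]
    rw [Real.exp_nat_mul, Real.exp_log (inv_pos.2 hX), mul_inv, inv_inv, ← div_eq_mul_inv]
  rw [h1]
  gcongr

end Mat

end Literature.Barriers.QuantumFields

end
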